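import Summits.Ventures.PercRepro0.Pivotal
import Summits.Ventures.PercRepro0.PlanarGlue

/-!
# Theorem S2 and P5 · SHARPNESS (seat p4, block P5 in Lean: S2, part 2)

SHARP-p4-v2 §4 on `Defs`, assembled with Theorem S1 (`Decay.lean`) into the route statement
`Defs.P5_Sharpness d`:

* `phi_mono`: `p ↦ φ_p(S)` is nondecreasing (L1 on the increasing events `{0 ↔_S x}`);
* `thetaBox d n r = P_{clamp r}(0 ↔ ∂Λ_n)`: Russo's formula (`hasDerivAt_thetaBox`), the bound `θ_n < 1` on `[0,1)`
  (`thetaBox_lt_one`, all bonds at `0` closed), and Lemma 4.1 in derivative form (`deriv_thetaBox_ge`): if `φ_q(A) ≥ 1`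
  for every finite `A ∋ 0`, then `θ_n′(q) ≥ (1 − θ_n(q)) / (q(1 − q))`;
* **Theorem S2** in contrapositive form (`pc_le_of_phi_ge`): if `φ_q(A) ≥ 1` for every finite `A ∋ 0` and every
  `q ≥ p` (`0 < p < 1`), then `p_c(d) ≤ p` — the integration step `Planar.lower_bound_of_deriv_ge` gives
  `θ_n(p′) ≥ (p′ − p)/(p′(1 − p)) > 0` uniformly in `n` for `p < p′ < 1`, hence `θ(p′) > 0` and `p_c ≤ p′`;
* hence below `p_c` some finite `S ∋ 0` has `φ_p(S) < 1` (`exists_phi_lt_one`, i.e. `p_c ≤ p̃_c`), every finite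
  set lies in a box (`exists_box_bound`), and Corollary S1′ (`Decay.exp_decay_of_phi_lt_one`) gives
  **`P5_Sharpness_holds (hd : 1 ≤ d) : P5_Sharpness d`**; the degenerate `d = 0` (`ℤ^0` is a point, `p_c(0) = 0`)
  is vacuous (`P5_Sharpness_zero`), so **`P5_Sharpness_holds' d : P5_Sharpness d`** for every `d`.
-/

namespace Summit.Ventures.PercRepro0.Sharp

open MeasureTheory ProbabilityTheory unitInterval Set Filter
open Summit.Ventures.PercRepro0.Defs
open scoped ENNReal Classical Topology

variable {d : ℕ}

/-! ### Monotonicity of `φ` in `p` -/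

/-- L1 for the events `{0 ↔_S x}`. -/
theorem P_connIn_mono (S : Finset (Vertex d)) (x : Vertex d) {p q : I} (hpq : p ≤ q) :
    P d p {ω : Config d | ConnIn (↑S) ω 0 x} ≤ P d q {ω : Config d | ConnIn (↑S) ω 0 x} :=
  setBernoulli_mono_of_isUpperSet (bonds d) hpq (fun _ _ h hc => connIn_mono_config h hc)
    (measurableSet_connIn S.finite_toSet 0 x)

/-- `p ↦ φ_p(S)` is nondecreasing. -/
theorem phi_mono (S : Finset (Vertex d)) {p q : I} (hpq : p ≤ q) : phi S p ≤ phi S q := by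
  unfold phi
  have h1 : (p : ℝ) ≤ q := hpq
  refine mul_le_mul h1 (Finset.sum_le_sum fun x _ => ?_)
    (Finset.sum_nonneg fun x _ => mul_nonneg (Nat.cast_nonneg _) ENNReal.toReal_nonneg) q.2.1
  exact mul_le_mul_of_nonneg_left
    (ENNReal.toReal_mono (measure_ne_top _ _) (P_connIn_mono S x hpq)) (Nat.cast_nonneg _)

/-- `φ_0(S) = 0`. -/
theorem phi_zero (S : Finset (Vertex d)) : phi S 0 = 0 := by
  unfold phi
  simp

/-! ### `θ_n` as a function of the real parameter; Russo's formula and Lemma 4.1 -/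

/-- `θ_n(r) = P_{clamp r}(0 ↔ ∂Λ_n)`. -/
noncomputable def thetaBox (d n : ℕ) (r : ℝ) : ℝ := (P d (clamp r) (toBoundary d n)).toReal

/-- Russo's formula for `θ_n` (SHARP Lemma 1.3): `θ_n′(q) = ∑_{e ∈ E(Λ_n)} P_q(Piv_e(0 ↔ ∂Λ_n))` on `(0,1)`. -/
theorem hasDerivAt_thetaBox (n : ℕ) {q : ℝ} (hq0 : 0 < q) (hq1 : q < 1) :
    HasDerivAt (thetaBox d n)
      (∑ e ∈ boxBondsF d n, (P d (clamp q) (Russo.Piv e (toBoundary d n))).toReal) q :=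
  Russo.hasDerivAt_P q hq0 hq1 (boxBondsF_subset_bonds n) (determinedBy_toBoundary_boxBondsF n)
    (isUpperSet_toBoundary n)

/-- `θ_n(q) < 1` for `n ≥ 1` and `0 ≤ q < 1` (all bonds at `0` closed with positive probability). -/
theorem thetaBox_lt_one (n : ℕ) (hn : 1 ≤ n) {q : ℝ} (hq0 : 0 ≤ q) (hq1 : q < 1) :
    thetaBox d n q < 1 := by
  unfold thetaBox
  have h := theta_le_one_sub (d := d) (clamp q) hn
  have hq : ((clamp q : I) : ℝ) = q := Russo.coe_clamp_of_mem hq0 hq1.le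
  rw [hq] at h
  have : 0 < (1 - q) ^ (bondsAtZero d).card := pow_pos (by linarith) _
  linarith

/-- **Lemma 4.1 (SHARP §4) in derivative form.** If `φ_q(A) ≥ 1` for every finite `A ∋ 0`, then
`θ_n′(q) ≥ (1 − θ_n(q)) / (q(1 − q))`. -/
theorem deriv_thetaBox_ge (n : ℕ) {q : ℝ} (hq0 : 0 < q) (hq1 : q < 1)
    (hφ : ∀ A : Finset (Vertex d), (0 : Vertex d) ∈ A → 1 ≤ phi A (clamp q)) :
    (1 - thetaBox d n q) / (q * (1 - q)) ≤ deriv (thetaBox d n) q := by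
  rw [(hasDerivAt_thetaBox n hq0 hq1).deriv]
  have hq : ((clamp q : I) : ℝ) = q := Russo.coe_clamp_of_mem hq0.le hq1.le
  have h := one_sub_le_mul_sum_piv n (clamp q) hφ
  rw [hq] at h
  have hpos : 0 < q * (1 - q) := mul_pos hq0 (by linarith)
  rw [div_le_iff₀ hpos]
  unfold thetaBox
  calc 1 - (P d (clamp q) (toBoundary d n)).toReal
      ≤ q * (1 - q) * ∑ e ∈ boxBondsF d n, (P d (clamp q) (Russo.Piv e (toBoundary d n))).toReal := h
    _ = (∑ e ∈ boxBondsF d n, (P d (clamp q) (Russo.Piv e (toBoundary d n))).toReal) * (q * (1 - q)) := by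
        ring

/-! ### Theorem S2: `p_c ≤ p̃_c` -/

/-- **Theorem S2, contrapositive form** (SHARP §4). If `φ_q(A) ≥ 1` for every finite `A ∋ 0` and every `q ≥ p`,
where `0 < p < 1`, then `p_c(d) ≤ p` (`d ≥ 1`): for `p < p′ < 1` the integration step gives
`θ_n(p′) ≥ (p′ − p)/(p′(1 − p)) > 0` for every `n ≥ 1`, hence `θ(p′) > 0`. -/
theorem pc_le_of_phi_ge (hd : 1 ≤ d) {p : I} (hp0 : 0 < (p : ℝ)) (hp1 : (p : ℝ) < 1)
    (hφ : ∀ q : I, p ≤ q → ∀ A : Finset (Vertex d), (0 : Vertex d) ∈ A → 1 ≤ phi A q) :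
    pc d ≤ p := by
  by_contra hcon'
  have hcon : (p : ℝ) < pc d := not_le.mp hcon'
  have hpc1 : pc d ≤ 1 := pc_le_one hd
  set p' : ℝ := ((p : ℝ) + pc d) / 2 with hp'
  have hp'1 : (p : ℝ) < p' := by rw [hp']; linarith
  have hp'2 : p' < pc d := by rw [hp']; linarith
  have hp'3 : p' < 1 := by linarith
  have hp'0 : 0 < p' := by linarith
  have hδpos : 0 < (p' - p) / (p' * (1 - p)) := div_pos (by linarith) (mul_pos hp'0 (by linarith))
  -- the uniform lower bound on `θ_n(p′)`, `n ≥ 1`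
  have hbound : ∀ n : ℕ, 1 ≤ n → (p' - p) / (p' * (1 - p)) ≤ thetaBox d n p' := by
    intro n hn
    refine Planar.lower_bound_of_deriv_ge (thetaBox d n) p hp0 hp1 ?_ ?_ ?_ ?_ ⟨hp'1, hp'3⟩
    · intro q hq
      exact (hasDerivAt_thetaBox n hq.1 hq.2).differentiableAt
    · intro q _
      exact ENNReal.toReal_nonneg
    · intro q hq
      exact thetaBox_lt_one n hn hq.1.le hq.2
    · intro q hq
      refine deriv_thetaBox_ge n (by linarith [hq.1]) hq.2 fun A h0A => hφ (clamp q) ?_ A h0A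
      have hpq : (p : ℝ) ≤ ((clamp q : I) : ℝ) := by
        rw [Russo.coe_clamp_of_mem (by linarith [hq.1]) hq.2.le]
        exact hq.1.le
      exact hpq
  -- `θ(p′) ≥ (p′ − p)/(p′(1 − p)) > 0`, so `p′ ∈ pcSet d` and `p_c ≤ p′ < p_c`
  have hθ : (p' - p) / (p' * (1 - p)) ≤ theta d p' := by
    unfold theta
    refine ge_of_tendsto (tendsto_P_toBoundary (d := d) (clamp p')) ?_
    rw [Filter.eventually_atTop]
    exact ⟨1, fun n hn => hbound n hn⟩
  have hmem : p' ∈ pcSet d := ⟨⟨hp'0.le, hp'3.le⟩, lt_of_lt_of_le hδpos hθ⟩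
  have : pc d ≤ p' := csInf_le pcSet_bddBelow hmem
  linarith

/-- **`p_c ≤ p̃_c`** (SHARP Theorem S2 + Lemma 2.3): below `p_c(d)` some finite `A ∋ 0` has `φ_p(A) < 1` (`d ≥ 1`). -/
theorem exists_phi_lt_one (hd : 1 ≤ d) {p : I} (hp : (p : ℝ) < pc d) :
    ∃ A : Finset (Vertex d), (0 : Vertex d) ∈ A ∧ phi A p < 1 := by
  by_contra hcon'
  have hcon : ∀ A : Finset (Vertex d), (0 : Vertex d) ∈ A → 1 ≤ phi A p :=
    fun A h0A => not_lt.mp fun hlt => hcon' ⟨A, h0A, hlt⟩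
  have hp0 : 0 < (p : ℝ) := by
    rcases eq_or_lt_of_le p.2.1 with h | h
    · exfalso
      have hp0' : p = 0 := Subtype.ext h.symm
      have := hcon {0} (Finset.mem_singleton_self _)
      rw [hp0', phi_zero] at this
      linarith
    · exact h
  have hp1 : (p : ℝ) < 1 := lt_of_lt_of_le hp (pc_le_one hd)
  have := pc_le_of_phi_ge hd hp0 hp1 fun q hpq A h0A => le_trans (hcon A h0A) (phi_mono A hpq)
  linarith

/-! ### P5 · SHARPNESS -/

/-- Every finite set of vertices lies in some box `Λ_{L−1}`, `L ≥ 1`. -/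
theorem exists_box_bound (A : Finset (Vertex d)) :
    ∃ L : ℕ, 1 ≤ L ∧ ∀ x ∈ A, ∀ i, |x i| + 1 ≤ L := by
  refine ⟨A.sup (fun x => Finset.univ.sup fun i : Fin d => (x i).natAbs) + 1, by omega,
    fun x hx i => ?_⟩
  have h1 : (x i).natAbs ≤ Finset.univ.sup fun j : Fin d => (x j).natAbs :=
    Finset.le_sup (f := fun j : Fin d => (x j).natAbs) (Finset.mem_univ i)
  have h2 : (Finset.univ.sup fun j : Fin d => (x j).natAbs) ≤
      A.sup (fun x => Finset.univ.sup fun i : Fin d => (x i).natAbs) :=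
    Finset.le_sup (f := fun x : Vertex d => Finset.univ.sup fun i : Fin d => (x i).natAbs) hx
  have h3 : |x i| = ((x i).natAbs : ℤ) := (Int.natCast_natAbs (x i)).symm
  rw [h3]
  push_cast
  omega

/-- **P5 · SHARPNESS holds** (`d ≥ 1`): below `p_c(d)`, `P_p(0 ↔ ∂Λ_n) ≤ e^{−cn}` for all `n ≥ 1`, for some `c > 0`. -/
theorem P5_Sharpness_holds (hd : 1 ≤ d) : P5_Sharpness d := by
  intro p hp
  obtain ⟨A, h0A, hphi⟩ := exists_phi_lt_one hd hp
  obtain ⟨L, hL, hAL⟩ := exists_box_bound A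
  exact exp_decay_of_phi_lt_one p (lt_of_lt_of_le hp (pc_le_one hd)) A h0A hL hAL hphi

/-- `d = 0`: `ℤ^0` is a point, so `θ_0 ≡ 0`, `p_c(0) = 0` and P5 holds vacuously. -/
theorem P5_Sharpness_zero : P5_Sharpness 0 := by
  intro p hp
  exfalso
  have hθ : ∀ q : I, thetaI 0 q = 0 := by
    intro q
    have hemp : percolates 0 = (∅ : Set (Config 0)) := by
      ext ω
      simp only [percolates, Set.mem_setOf_eq, Set.mem_empty_iff_false, iff_false]
      intro h
      have hsub : cluster 0 ω 0 ⊆ {0} := fun y _ => Subsingleton.elim y 0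
      exact h ((Set.finite_singleton _).subset hsub)
    unfold thetaI
    rw [hemp, measure_empty]
    simp
  have hset : pcSet 0 = ∅ := by
    ext q
    simp only [pcSet, Set.mem_setOf_eq, Set.mem_empty_iff_false, iff_false]
    rintro ⟨-, hq⟩
    rw [theta, hθ] at hq
    exact lt_irrefl _ hq
  have hpc : pc 0 = 0 := by rw [pc, hset, Real.sInf_empty]
  rw [hpc] at hp
  exact absurd hp (not_lt.2 p.2.1)

/-- **P5 · SHARPNESS holds for every `d`.** -/
theorem P5_Sharpness_holds' (d : ℕ) : P5_Sharpness d := by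
  rcases Nat.eq_zero_or_pos d with rfl | hd
  · exact P5_Sharpness_zero
  · exact P5_Sharpness_holds hd

end Summit.Ventures.PercRepro0.Sharp
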